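import Mathlib
import Summits.Ventures.PercRepro.TriangleCapRowTopLayers
import Summits.Ventures.PercRepro.TriangleCapTopCherries

/-!
# PercRepro — THE BIPARTITE CHERRY SPECTRUM OF EVERY ROW `a ≥ 2` AT EVERY LAYER, EXACT; AND THE CHERRY FORMS OF THE
ROW THEOREMS (p3, gen 51; part 241)

`bipSub_row_band_exact` (`2 ≤ a`, `1 ≤ t`, `4 t + 3 ≤ r`, `2 r ≥ 4 t + 6 + t (t + 1)`, `a + t < r`, `a + r ≤ k`,
`r + 1 ≤ k`): among the `a`-bipartite graphs with `a (k − a) − r` edges the band `t` is EXACTLY the interval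
`2 j + 2 q t ≤ 2 t + t (t − 1) + (a − 1) q (q + 1)`, `q = ⌊t / (a − 1)⌋` — no `K₄⁻`-free stability needed, so the row
`a = 2` is included.  `cherry_row_band_exact_cherries` and `cherry_row_top_layers_cherries` are the
`2·cherries` forms of parts 239–240.  Axioms: standard.
-/

namespace PercRepro

namespace TriangleCap

namespace C047

open Finset

/-- **THE BIPARTITE CHERRY SPECTRUM OF THE ROW `a` AT THE LAYER `t`, EXACT** (`2 ≤ a`, `1 ≤ t`, `4 t + 3 ≤ r`,
`2 r ≥ 4 t + 6 + t (t + 1)`, `a + t < r`, `a + r ≤ k`, `r + 1 ≤ k`; `q = ⌊t / (a − 1)⌋`): (i) an `a`-bipartite graph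
(`BipSub D A`, `|A| = a`) with `a (k − a) − r` edges at the band value `closed − (2 t (r − t − 1) + 2 j)` has
`2 j + 2 q t ≤ 2 t + t (t − 1) + (a − 1) q (q + 1)`; (ii) every such `j` is attained by an `a`-bipartite graph. -/
theorem bipSub_row_band_exact (k a r t : ℕ) (ha2 : 2 ≤ a) (ht : 1 ≤ t) (hr4 : 4 * t + 3 ≤ r)
    (hr : 4 * t + 6 + t * (t + 1) ≤ 2 * r) (hat : a + t < r) (hak : a + r ≤ k) (hk : r + 1 ≤ k) :
    (∀ (D : SimpleGraph (Fin k)) [DecidableRel D.Adj] (A : Finset (Fin k)), A.card = a → BipSub D A →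
        D.edgeFinset.card + r = a * (k - a) → ∀ j, 2 * j ≤ t * (t + 1) →
        ∑ v, deg D v * deg D v + r * (k - 1 - r) + (2 * (t * (r - t - 1)) + 2 * j) = D.edgeFinset.card * k →
        2 * j + 2 * (t / (a - 1)) * t ≤ 2 * t + t * (t - 1) + (a - 1) * ((t / (a - 1)) * (t / (a - 1) + 1))) ∧
      (∀ j, 2 * j + 2 * (t / (a - 1)) * t ≤ 2 * t + t * (t - 1) + (a - 1) * ((t / (a - 1)) * (t / (a - 1) + 1)) →
        ∃ (D : SimpleGraph (Fin k)) (_ : DecidableRel D.Adj) (A : Finset (Fin k)), A.card = a ∧ BipSub D A ∧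
          D.edgeFinset.card + r = a * (k - a) ∧
          ∑ v, deg D v * deg D v + r * (k - 1 - r) + (2 * (t * (r - t - 1)) + 2 * j) =
            D.edgeFinset.card * k) := by
  have hcard : Fintype.card (Fin k) = k := Fintype.card_fin k
  refine ⟨?_, ?_⟩
  · intro D _ A hA hB hm j hj heq
    -- the star centre of the missing graph
    have hH := bipSub_sum_deg_sq_add_disjEdgePairs D A hB a r hA (by rw [hcard]; exact hm) (by rw [hcard]; exact hk)
    rw [hcard] at hH
    have hr' : (missingGraph D A).edgeFinset.card = r :=
      card_edges_missingGraph D A hB a r hA (by rw [hcard]; exact hm)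
    have hid := sum_deg_sq_add_disjEdgePairs (missingGraph D A)
    rw [hr'] at hid
    have hS : ∑ v, deg (missingGraph D A) v * deg (missingGraph D A) v + 2 * (t * (r - t - 1)) + 2 * j =
        r * (r + 1) := by
      omega
    obtain ⟨w, hw, -, -⟩ := layer_band_locus (missingGraph D A) (cliqueFree_of_bipSub _ A (bipSub_missingGraph D A))
      t r ht hr hr4 hr' j hj hS
    have hwA : w ∈ A := by
      by_contra hwA
      have h1 := deg_add_deg_missingGraph D A hB w
      rw [if_neg hwA, hA] at h1
      omega
    exact row_band_bound k a r t j hk D A hA hB hm w hwA hw (by omega) heq (t / (a - 1))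
  · intro j hj
    have hℓ : 1 ≤ a - 1 := by omega
    have hthr := row_threshold (a - 1) t
    have hcoll := coll_lfRR_zero (a - 1) t (by omega)
    have hj' : 2 * j + coll t (lfRR (a - 1) 0) ≤ 2 * t + t * (t - 1) := by omega
    obtain ⟨u, hu, m, hm, hjm⟩ := stair_attained (a - 1) t j hj'
    have hlf : ∀ i, i < t → 1 ≤ lfRR (a - 1) u i ∧ lfRR (a - 1) u i < a := fun i _ => by
      have := lfRR_bounds (a - 1) u i hℓ
      omega
    obtain ⟨-, hE, hS⟩ := rowWitness_value k a r t m (lfRR (a - 1) u) ht hm hlf (by omega) (by omega) hak hk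
    refine ⟨rowWitness k a r t m (by omega) (lfRR (a - 1) u), inferInstance, leftPart k a,
      card_leftPart k a (by omega), bipSub_rowWitness k a r t m (by omega) (lfRR (a - 1) u), hE, ?_⟩
    rw [hjm]
    exact hS

/-- **THE BAND `t` OF THE ROW `a`, CHERRY FORM** (the hypotheses of `cherry_row_band_exact`). -/
theorem cherry_row_band_exact_cherries (k a r t : ℕ) (ha3 : 3 ≤ a) (ht : 1 ≤ t) (hr4 : 4 * t + 3 ≤ r)
    (hr : 4 * t + 6 + t * (t + 1) ≤ 2 * r) (hat : a + t < r) (hk : 2 * a + r ≤ k) (hk3 : a = 3 → r + 7 ≤ k)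
    (hlt : 2 * (t * (r - t - 1)) + t * (t + 1) < stabGapFull k a r) :
    (∀ (D : SimpleGraph (Fin k)) [DecidableRel D.Adj], K4mFree D → D.edgeFinset.card + r = a * (k - a) →
        ∀ j, 2 * j ≤ t * (t + 1) →
        2 * cherries D + r * (k - 1 - r) + (2 * (t * (r - t - 1)) + 2 * j) = D.edgeFinset.card * (k - 2) →
        2 * j + 2 * (t / (a - 1)) * t ≤ 2 * t + t * (t - 1) + (a - 1) * ((t / (a - 1)) * (t / (a - 1) + 1))) ∧
      (∀ j, 2 * j + 2 * (t / (a - 1)) * t ≤ 2 * t + t * (t - 1) + (a - 1) * ((t / (a - 1)) * (t / (a - 1) + 1)) →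
        ∃ (D : SimpleGraph (Fin k)) (_ : DecidableRel D.Adj), K4mFree D ∧ D.edgeFinset.card + r = a * (k - a) ∧
          2 * cherries D + r * (k - 1 - r) + (2 * (t * (r - t - 1)) + 2 * j) =
            D.edgeFinset.card * (k - 2)) := by
  have hk2 : 2 ≤ k := by omega
  obtain ⟨h1, h2⟩ := cherry_row_band_exact k a r t ha3 ht hr4 hr hat hk hk3 hlt
  refine ⟨?_, ?_⟩
  · intro D _ hK hm j hj heq
    have := (gap_eq_iff_cherries k hk2 D (r * (k - 1 - r) + (2 * (t * (r - t - 1)) + 2 * j))).mpr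
      (by rw [← add_assoc]; exact heq)
    rw [← add_assoc] at this
    exact h1 D hK hm j hj this
  · intro j hj
    obtain ⟨D, inst, hK, hE, hS⟩ := h2 j hj
    refine ⟨D, inst, hK, hE, ?_⟩
    have := (gap_eq_iff_cherries k hk2 D (r * (k - 1 - r) + (2 * (t * (r - t - 1)) + 2 * j))).mp
      (by rw [← add_assoc]; exact hS)
    rw [add_assoc]
    exact this

/-- **THE FIRST `T` LAYERS OF THE ROW `a`, CHERRY FORM** (the hypotheses of `cherry_row_top_layers`). -/
theorem cherry_row_top_layers_cherries (k a r T : ℕ) (ha3 : 3 ≤ a) (hr4 : 4 * T + 3 ≤ r)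
    (hr : 4 * T + 6 + T * (T + 1) ≤ 2 * r) (hat : a + T < r) (hk : 2 * a + r ≤ k) (hk3 : a = 3 → r + 7 ≤ k)
    (hgap : 2 * ((T + 1) * (r - T - 2)) ≤ stabGapFull k a r) :
    (∀ (D : SimpleGraph (Fin k)) [DecidableRel D.Adj], K4mFree D → D.edgeFinset.card + r = a * (k - a) →
        D.edgeFinset.card * (k - 2) < 2 * cherries D + r * (k - 1 - r) + 2 * ((T + 1) * (r - T - 2)) →
        ∃ t, t ≤ T ∧ ∃ j, 2 * j ≤ t * (t + 1) ∧
          2 * j + 2 * (t / (a - 1)) * t ≤ 2 * t + t * (t - 1) + (a - 1) * ((t / (a - 1)) * (t / (a - 1) + 1)) ∧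
          2 * cherries D + r * (k - 1 - r) + (2 * (t * (r - t - 1)) + 2 * j) = D.edgeFinset.card * (k - 2)) ∧
      (∀ t, t ≤ T → ∀ j, 2 * j ≤ t * (t + 1) →
        2 * j + 2 * (t / (a - 1)) * t ≤ 2 * t + t * (t - 1) + (a - 1) * ((t / (a - 1)) * (t / (a - 1) + 1)) →
        ∃ (D : SimpleGraph (Fin k)) (_ : DecidableRel D.Adj), K4mFree D ∧ D.edgeFinset.card + r = a * (k - a) ∧
          2 * cherries D + r * (k - 1 - r) + (2 * (t * (r - t - 1)) + 2 * j) =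
            D.edgeFinset.card * (k - 2)) := by
  have hk2 : 2 ≤ k := by omega
  obtain ⟨h1, h2⟩ := cherry_row_top_layers k a r T ha3 hr4 hr hat hk hk3 hgap
  refine ⟨?_, ?_⟩
  · intro D _ hK hm hlt
    have hlt' : D.edgeFinset.card * k <
        ∑ v, deg D v * deg D v + r * (k - 1 - r) + 2 * ((T + 1) * (r - T - 2)) := by
      by_contra hle
      have := (gap_le_iff_cherries k hk2 D (r * (k - 1 - r) + 2 * ((T + 1) * (r - T - 2)))).mp
        (by rw [← add_assoc]; exact not_lt.mp hle)
      omega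
    obtain ⟨t, ht, j, hj, hjq, h⟩ := h1 D hK hm hlt'
    refine ⟨t, ht, j, hj, hjq, ?_⟩
    have := (gap_eq_iff_cherries k hk2 D (r * (k - 1 - r) + (2 * (t * (r - t - 1)) + 2 * j))).mp
      (by rw [← add_assoc]; exact h)
    rw [add_assoc]
    exact this
  · intro t ht j hj hjq
    obtain ⟨D, inst, hK, hE, hS⟩ := h2 t ht j hj hjq
    refine ⟨D, inst, hK, hE, ?_⟩
    have := (gap_eq_iff_cherries k hk2 D (r * (k - 1 - r) + (2 * (t * (r - t - 1)) + 2 * j))).mp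
      (by rw [← add_assoc]; exact hS)
    rw [add_assoc]
    exact this

end C047

end TriangleCap

end PercRepro
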